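import Summits.Ventures.Crystal3D.Theorems.StickyWulffConstantCoaxialWallLawExitsBelow
import Summits.Ventures.Crystal3D.Theorems.StickyWulffConstantCoaxialWallLawRigidAll
import Summits.Ventures.Crystal3D.Theorems.StickyWulffConstantGenericWallFloorShellCount
import HarnessLib

/-!
# On-grain exits are born below the top sample — every pair of distinct grains; the `(ρ−3)`-rim count

HONEST FRAMING. Part of the venture `Summits/Ventures/Crystal3D` (cell `crystal3d-full`), helper
`--supports` the crux `CoaxialWallLaw` (stmt-Ventures-19481, `route-Ventures-StickyWulffConstant`),
REGISTERED line `WallLedgerF` (planner cf-p1 gen 16), stub `stub_coaxialTwoSlabAdhesion`.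
Brick F-N1 of the general-filling port, UNIFIED form (one lemma to cite): for every pair of moved fcc
lattices with `Λ₁ ≠ Λ₂` (co-axial or not), in the two-sample cell with an ARBITRARY unit-separated filling,
the `u`-exits of grain 1 lying on grain-1 sites, below height `h + R₀ + 2` and of lateral radius `≤ ρ − 3`
number at least `√2 |⟪A₁u, e₃⟫| π (ρ−1)² − 10√2 π (ρ−1) − 30 (h + 4R₀ + 2)(2ρ − 3)`.
Cases: `A₁·Λ₀ ≠ A₂·Λ₀` → `exit_below_of_linear_ne` (`…ExitsBelow`); `A₁·Λ₀ = A₂·Λ₀` → the grains are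
disjoint (`movedFcc_subset_of_common_point`, `…RigidAll`) → `onGrain_below_topSample` (`…ExitsOnGrain`).
The rim term is `card_cellRim3_le` (shell count `card_mul_le_of_separated_in_shell` at radii `(ρ−3, ρ]`).
Rung credit only; F-C1 not moved.
-/

noncomputable section

namespace Summit.Ventures.Crystal3D.Theorems

open Summit.Ventures.Crystal3D Finset
open Literature.MathematicalPhysics.StatisticalMechanics (fccStacking)
open scoped InnerProductSpace

/-- **The `(ρ−3)`-rim count.**  In a `1`-separated configuration inside `{lo ≤ x₂ ≤ hi} × disc ρ`
(`ρ ≥ 4`), the balls of lateral radius `> ρ − 3` number at most `30 (hi − lo + 2)(2ρ − 3)`. -/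
theorem card_cellRim3_le (X : Finset (EuclideanSpace ℝ (Fin 3)))
    (hsep : ∀ p ∈ X, ∀ q ∈ X, p ≠ q → 1 ≤ dist p q) (lo hi ρ : ℝ) (hlohi : lo ≤ hi) (hρ : 4 ≤ ρ)
    (hcell : ∀ p ∈ X, lo ≤ p 2 ∧ p 2 ≤ hi ∧ p 0 ^ 2 + p 1 ^ 2 ≤ ρ ^ 2) :
    (((X.filter fun p => (ρ - 3) ^ 2 < p 0 ^ 2 + p 1 ^ 2).card : ℕ) : ℝ) ≤
      30 * (hi - lo + 2) * (2 * ρ - 3) := by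
  classical
  set S := X.filter fun p => (ρ - 3) ^ 2 < p 0 ^ 2 + p 1 ^ 2 with hS
  have hSsep : ∀ p ∈ S, ∀ q ∈ S, p ≠ q → 1 ≤ dist p q :=
    fun p hp q hq hpq => hsep p (mem_filter.1 hp).1 q (mem_filter.1 hq).1 hpq
  have hmem : ∀ p ∈ S, lo ≤ p 2 ∧ p 2 ≤ hi ∧ (ρ - 3) ^ 2 < p 0 ^ 2 + p 1 ^ 2 ∧
      p 0 ^ 2 + p 1 ^ 2 ≤ ρ ^ 2 := by
    intro p hp
    obtain ⟨hpX, hpr⟩ := mem_filter.1 hp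
    obtain ⟨h1, h2, h3⟩ := hcell p hpX
    exact ⟨h1, h2, hpr, h3⟩
  have key := card_mul_le_of_separated_in_shell S hSsep lo hi (ρ - 3) ρ hlohi (by linarith) (by linarith)
    hmem
  have e : (hi - lo + 2) * (Real.pi * (ρ + 1) ^ 2 - Real.pi * (ρ - 3 - 1) ^ 2) =
      (Real.pi / 6) * (30 * (hi - lo + 2) * (2 * ρ - 3)) := by ring
  rw [e] at key
  have hπ : 0 < Real.pi / 6 := by positivity
  nlinarith

/-- **On-grain exits are born below the top sample (all pairs of distinct grains).**  A `u`-exit `e` of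
grain 1 on a grain-1 site with lateral radius `≤ ρ − 3` has height `< h + R₀ + 2`. -/
theorem onGrain_exit_below
    (A₁ : EuclideanSpace ℝ (Fin 3) ≃ₗᵢ[ℝ] EuclideanSpace ℝ (Fin 3)) (t₁ : EuclideanSpace ℝ (Fin 3))
    (A₂ : EuclideanSpace ℝ (Fin 3) ≃ₗᵢ[ℝ] EuclideanSpace ℝ (Fin 3)) (t₂ : EuclideanSpace ℝ (Fin 3))
    (hne : (fun p => A₁ p + t₁) '' fccStacking 1 (Real.sqrt (2 / 3)) ≠
      (fun p => A₂ p + t₂) '' fccStacking 1 (Real.sqrt (2 / 3)))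
    (X P₂ : Finset (EuclideanSpace ℝ (Fin 3))) (R₀ h ρ : ℝ) (hR₀ : 2 ≤ R₀) (hρ : 3 ≤ ρ)
    (hX : ∀ p ∈ X, ∀ q ∈ X, p ≠ q → 1 ≤ dist p q) (hP₂X : P₂ ⊆ X)
    (hcell : ∀ p ∈ X, -(2 * R₀) ≤ p 2 ∧ p 2 ≤ h + 2 * R₀ ∧ p 0 ^ 2 + p 1 ^ 2 ≤ ρ ^ 2)
    (hP₂ : ∀ p, p ∈ P₂ ↔ (p ∈ (fun q => A₂ q + t₂) '' fccStacking 1 (Real.sqrt (2 / 3)) ∧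
      h + R₀ ≤ p 2 ∧ p 2 ≤ h + 2 * R₀ ∧ p 0 ^ 2 + p 1 ^ 2 ≤ ρ ^ 2))
    {u : EuclideanSpace ℝ (Fin 3)} (hu : u ∈ fccSlots) {e : EuclideanSpace ℝ (Fin 3)} (heX : e ∈ X)
    (heΛ : e ∈ (fun q => A₁ q + t₁) '' fccStacking 1 (Real.sqrt (2 / 3)))
    (hpred : e - A₁ u ∈ X) (hfull : ∀ w ∈ fccSlots, e - A₁ u + A₁ w ∈ X)
    (her : e 0 ^ 2 + e 1 ^ 2 ≤ (ρ - 3) ^ 2) : e 2 < h + R₀ + 2 := by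
  by_cases hlin : A₁ '' fccStacking 1 (Real.sqrt (2 / 3)) = A₂ '' fccStacking 1 (Real.sqrt (2 / 3))
  · -- translation pair: disjoint grains, sealing
    have hdisj : ∀ p ∈ (fun q => A₁ q + t₁) '' fccStacking 1 (Real.sqrt (2 / 3)),
        p ∉ (fun q => A₂ q + t₂) '' fccStacking 1 (Real.sqrt (2 / 3)) := fun p hp₁ hp₂ =>
      hne (Set.Subset.antisymm (movedFcc_subset_of_common_point A₁ t₁ A₂ t₂ hlin hp₁ hp₂)
        (movedFcc_subset_of_common_point A₂ t₂ A₁ t₁ hlin.symm hp₂ hp₁))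
    have hr : e 0 ^ 2 + e 1 ^ 2 ≤ (ρ - 1) ^ 2 := by nlinarith
    have := onGrain_below_topSample A₁ t₁ A₂ t₂ hdisj X P₂ R₀ h ρ hR₀ (by linarith) hX hP₂X hcell hP₂
      heX heΛ hr
    linarith
  · exact exit_below_of_linear_ne A₁ A₂ t₂ hlin X P₂ R₀ h ρ hR₀ hρ hX hP₂X hcell hP₂ hu hpred hfull her

open scoped Classical in
/-- **F-N1, unified.**  For every pair of distinct grains, the grain-1 `u`-exits on grain-1 sites, below
height `h + R₀ + 2` and off the `(ρ−3)`-rim number at least the flux minus `O((1+h)ρ)`. -/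
theorem card_onGrain_exits_below_ge
    (A₁ : EuclideanSpace ℝ (Fin 3) ≃ₗᵢ[ℝ] EuclideanSpace ℝ (Fin 3)) (t₁ : EuclideanSpace ℝ (Fin 3))
    (A₂ : EuclideanSpace ℝ (Fin 3) ≃ₗᵢ[ℝ] EuclideanSpace ℝ (Fin 3)) (t₂ : EuclideanSpace ℝ (Fin 3))
    (hne : (fun p => A₁ p + t₁) '' fccStacking 1 (Real.sqrt (2 / 3)) ≠
      (fun p => A₂ p + t₂) '' fccStacking 1 (Real.sqrt (2 / 3)))
    (X P₁ P₂ : Finset (EuclideanSpace ℝ (Fin 3))) (R₀ h ρ : ℝ) (hR₀ : 3 ≤ R₀) (hh : 0 ≤ h)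
    (hρ : R₀ + 1 ≤ ρ)
    (hX : ∀ p ∈ X, ∀ q ∈ X, p ≠ q → 1 ≤ dist p q) (hP₁X : P₁ ⊆ X) (hP₂X : P₂ ⊆ X)
    (hcell : ∀ p ∈ X, -(2 * R₀) ≤ p 2 ∧ p 2 ≤ h + 2 * R₀ ∧ p 0 ^ 2 + p 1 ^ 2 ≤ ρ ^ 2)
    (hP₁ : ∀ p, p ∈ P₁ ↔ (p ∈ (fun q => A₁ q + t₁) '' fccStacking 1 (Real.sqrt (2 / 3)) ∧
      -(2 * R₀) ≤ p 2 ∧ p 2 ≤ -R₀ ∧ p 0 ^ 2 + p 1 ^ 2 ≤ ρ ^ 2))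
    (hP₂ : ∀ p, p ∈ P₂ ↔ (p ∈ (fun q => A₂ q + t₂) '' fccStacking 1 (Real.sqrt (2 / 3)) ∧
      h + R₀ ≤ p 2 ∧ p 2 ≤ h + 2 * R₀ ∧ p 0 ^ 2 + p 1 ^ 2 ≤ ρ ^ 2))
    {u : EuclideanSpace ℝ (Fin 3)} (hu : u ∈ fccSlots) :
    Real.sqrt 2 * |⟪A₁ u, EuclideanSpace.single (2 : Fin 3) (1 : ℝ)⟫_ℝ| * Real.pi * (ρ - 1) ^ 2 -
        10 * Real.sqrt 2 * Real.pi * (ρ - 1) - 30 * (h + 4 * R₀ + 2) * (2 * ρ - 3) ≤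
      (((X.filter fun e => e ∈ (fun q => A₁ q + t₁) '' fccStacking 1 (Real.sqrt (2 / 3)) ∧
          e 2 < h + R₀ + 2 ∧ e 0 ^ 2 + e 1 ^ 2 ≤ (ρ - 3) ^ 2 ∧
          e - A₁ u ∈ X ∧ (∀ w ∈ fccSlots, e - A₁ u + A₁ w ∈ X) ∧
          ∃ v ∈ fccSlots, e + A₁ v ∉ X).card : ℕ) : ℝ) := by
  have h1 := card_exits_onGrain_ge A₁ t₁ X P₁ R₀ ρ hR₀ (by linarith) hP₁X hP₁ hu
  have hrim := card_cellRim3_le X hX (-(2 * R₀)) (h + 2 * R₀) ρ (by linarith) (by linarith) hcell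
  set EX := X.filter fun e => e ∈ (fun q => A₁ q + t₁) '' fccStacking 1 (Real.sqrt (2 / 3)) ∧
      e - A₁ u ∈ X ∧ (∀ w ∈ fccSlots, e - A₁ u + A₁ w ∈ X) ∧ ∃ v ∈ fccSlots, e + A₁ v ∉ X with hEX
  set RIM := X.filter fun x => (ρ - 3) ^ 2 < x 0 ^ 2 + x 1 ^ 2 with hRIM
  set GOOD := X.filter fun e => e ∈ (fun q => A₁ q + t₁) '' fccStacking 1 (Real.sqrt (2 / 3)) ∧
      e 2 < h + R₀ + 2 ∧ e 0 ^ 2 + e 1 ^ 2 ≤ (ρ - 3) ^ 2 ∧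
      e - A₁ u ∈ X ∧ (∀ w ∈ fccSlots, e - A₁ u + A₁ w ∈ X) ∧ ∃ v ∈ fccSlots, e + A₁ v ∉ X with hGOOD
  have hsub : EX ⊆ GOOD ∪ RIM := by
    intro e he
    rw [hEX, mem_filter] at he
    obtain ⟨heX, heΛ, hpred, hfull, hlack⟩ := he
    rw [mem_union]
    by_cases hr : (ρ - 3) ^ 2 < e 0 ^ 2 + e 1 ^ 2
    · exact Or.inr (mem_filter.2 ⟨heX, hr⟩)
    · push Not at hr
      exact Or.inl (mem_filter.2 ⟨heX, heΛ, onGrain_exit_below A₁ t₁ A₂ t₂ hne X P₂ R₀ h ρ (by linarith)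
        (by linarith) hX hP₂X hcell hP₂ hu heX heΛ hpred hfull hr, hr, hpred, hfull, hlack⟩)
  have hcard : EX.card ≤ GOOD.card + RIM.card := (card_le_card hsub).trans (card_union_le _ _)
  have hcast : ((EX.card : ℕ) : ℝ) ≤ ((GOOD.card : ℕ) : ℝ) + ((RIM.card : ℕ) : ℝ) := by exact_mod_cast hcard
  have e : h + 2 * R₀ - -(2 * R₀) + 2 = h + 4 * R₀ + 2 := by ring
  rw [e] at hrim
  linarith

end Summit.Ventures.Crystal3D.Theorems

end
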